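import Summits.AtomisticToContinuum.FouriersLaw.Theorems.OddSectorIrreversibilityOddDensityIsCorrectorResolvent

/-!
# `OddDensityIsCorrector`, part 7: the resolvent is linear and `L²(μ_T)`-bounded by `1/λ`

Helper file for support item `stmt-AtomisticToContinuum-9146`
(`OddSectorIrreversibility.OddDensityIsCorrector`).

For the equilibrium kernels `P_t` of the pinned anharmonic chain and nice observables `f`
(continuous, `|f| ≤ C e^{ϑH}` with `0 < ϑ`, `2ϑ < 1/T`), `λ > 0`, and the resolvent
`R_λ f(z) = ∫_{(0,∞)} e^{-λt} P_t f(z) dt`: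

* `pinnedChain_act_add`, `pinnedChain_resolvent_add`, `pinnedChain_resolvent_const_mul`,
  `pinnedChain_resolvent_sub_generator` (`R_λ(λF - LF) = F` for test functions) — linearity;
* `pinnedChain_sq_resolvent_le` — Jensen in time: `(R_λ f(z))² ≤ λ⁻¹ ∫_{(0,∞)} e^{-λt} (P_t f(z))² dt`;
* `pinnedChain_integral_sq_resolvent_le` — **`∫ (R_λ f)² dμ_T ≤ λ⁻² ∫ f² dμ_T`** (Tonelli and the
  `L²(μ_T)`-contraction of `P_t`, `pinnedChain_integral_sq_act_le`), with the integrability of `(R_λ f)²`.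

Nothing here closes an item.
-/

noncomputable section

open MeasureTheory ProbabilityTheory Filter Topology Set Function
open scoped ContDiff NNReal ENNReal
open Literature.MathematicalPhysics.KineticTheory.HeatConduction
open Summit.AtomisticToContinuum.FouriersLaw.Theorems.SubdiffusiveBondHeat

namespace Summit.AtomisticToContinuum.FouriersLaw.Theorems.OddSectorIrreversibility

variable {N : ℕ}

section Pinned

variable {ω₂ lam β γ : ℝ} (hω : 0 < ω₂) (hl : 0 ≤ lam) (hβ : 0 < β) (hγ : 0 < γ) (hN : 0 < N)
  {T : ℝ} (hT : 0 < T)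
include hω hl hβ hγ hN hT

/-! ### Linearity -/

omit hβ hγ in
/-- Nice observables are integrable for every transition kernel: `P_t(f)` is an honest expectation.
[folklore] -/
theorem pinnedChain_integrable_transitionKernel_of_abs_le (hβ' : 0 ≤ β) (hγ' : 0 ≤ γ) {ϑ : ℝ} (hϑ0 : 0 < ϑ)
    (hϑ1 : ϑ < 1 / T) {f : PhaseSpace N → ℝ} (hf : Continuous f) {C : ℝ}
    (hfb : ∀ y, |f y| ≤ C * Real.exp (ϑ * (pinnedChain ω₂ lam β γ).hamiltonian N y)) (t : ℝ≥0)
    (z : PhaseSpace N) :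
    Integrable f ((pinnedChain ω₂ lam β γ).transitionKernel N T T t z) :=
  integrable_of_abs_le_exp (pinnedChain_integrable_exp_mul_hamiltonian_transitionKernel hω hl hT hβ' hγ' hN hϑ0 hϑ1 t z)
    hf hfb

omit hβ hγ in
/-- `P_t (f + g) = P_t f + P_t g` for nice `f, g`. [folklore] -/
theorem pinnedChain_act_add (hβ' : 0 ≤ β) (hγ' : 0 ≤ γ) {ϑ : ℝ} (hϑ0 : 0 < ϑ) (hϑ1 : ϑ < 1 / T)
    {f g : PhaseSpace N → ℝ} (hf : Continuous f) (hg : Continuous g) {Cf Cg : ℝ}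
    (hfb : ∀ y, |f y| ≤ Cf * Real.exp (ϑ * (pinnedChain ω₂ lam β γ).hamiltonian N y))
    (hgb : ∀ y, |g y| ≤ Cg * Real.exp (ϑ * (pinnedChain ω₂ lam β γ).hamiltonian N y)) (t : ℝ≥0)
    (z : PhaseSpace N) :
    ∫ y, (f y + g y) ∂((pinnedChain ω₂ lam β γ).transitionKernel N T T t z) =
      (∫ y, f y ∂((pinnedChain ω₂ lam β γ).transitionKernel N T T t z)) +
        ∫ y, g y ∂((pinnedChain ω₂ lam β γ).transitionKernel N T T t z) :=
  integral_add (pinnedChain_integrable_transitionKernel_of_abs_le hω hl hN hT hβ' hγ' hϑ0 hϑ1 hf hfb t z)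
    (pinnedChain_integrable_transitionKernel_of_abs_le hω hl hN hT hβ' hγ' hϑ0 hϑ1 hg hgb t z)

omit hω hl hβ hγ hN hT in
/-- The sum of two nice observables is nice (with constant `Cf + Cg`). [folklore] -/
theorem abs_add_le_exp_bound {ϑ : ℝ} {f g : PhaseSpace N → ℝ} {Cf Cg : ℝ}
    (hfb : ∀ y, |f y| ≤ Cf * Real.exp (ϑ * (pinnedChain ω₂ lam β γ).hamiltonian N y))
    (hgb : ∀ y, |g y| ≤ Cg * Real.exp (ϑ * (pinnedChain ω₂ lam β γ).hamiltonian N y)) (y : PhaseSpace N) :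
    |f y + g y| ≤ (Cf + Cg) * Real.exp (ϑ * (pinnedChain ω₂ lam β γ).hamiltonian N y) := by
  have := abs_add_le (f y) (g y)
  have h1 := hfb y; have h2 := hgb y
  linarith

omit hω hl hβ hγ hN hT in
/-- A constant multiple of a nice observable is nice. [folklore] -/
theorem abs_const_mul_le_exp_bound {ϑ : ℝ} {f : PhaseSpace N → ℝ} {Cf : ℝ} (a : ℝ)
    (hfb : ∀ y, |f y| ≤ Cf * Real.exp (ϑ * (pinnedChain ω₂ lam β γ).hamiltonian N y)) (y : PhaseSpace N) :
    |a * f y| ≤ (|a| * Cf) * Real.exp (ϑ * (pinnedChain ω₂ lam β γ).hamiltonian N y) := by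
  rw [abs_mul, mul_assoc]
  exact mul_le_mul_of_nonneg_left (hfb y) (abs_nonneg a)

/-- **`R_λ (f + g) = R_λ f + R_λ g`** pointwise, for nice `f, g` and `λ > 0`. [folklore] -/
theorem pinnedChain_resolvent_add {ϑ : ℝ} (hϑ0 : 0 < ϑ) (hϑ1 : ϑ < 1 / T)
    {f g : PhaseSpace N → ℝ} (hf : Continuous f) (hg : Continuous g) {Cf Cg : ℝ} (hCf : 0 ≤ Cf) (hCg : 0 ≤ Cg)
    (hfb : ∀ y, |f y| ≤ Cf * Real.exp (ϑ * (pinnedChain ω₂ lam β γ).hamiltonian N y))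
    (hgb : ∀ y, |g y| ≤ Cg * Real.exp (ϑ * (pinnedChain ω₂ lam β γ).hamiltonian N y))
    {lam' : ℝ} (hlam : 0 < lam') (z : PhaseSpace N) :
    ∫ t in Ioi (0 : ℝ), Real.exp (-(lam' * t)) *
        ∫ y, (f y + g y) ∂((pinnedChain ω₂ lam β γ).transitionKernel N T T t.toNNReal z) =
      (∫ t in Ioi (0 : ℝ), Real.exp (-(lam' * t)) *
        ∫ y, f y ∂((pinnedChain ω₂ lam β γ).transitionKernel N T T t.toNNReal z)) +
      ∫ t in Ioi (0 : ℝ), Real.exp (-(lam' * t)) *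
        ∫ y, g y ∂((pinnedChain ω₂ lam β γ).transitionKernel N T T t.toNNReal z) := by
  obtain ⟨K, c, -, hc, hb⟩ := pinnedChain_harris_bound hω hl hβ hγ hN hT hϑ0 hϑ1
  have iF := pinnedChain_integrableOn_resolvent hω hl hβ hγ hϑ0 hb hc hf hCf hfb hlam z
  have iG := pinnedChain_integrableOn_resolvent hω hl hβ hγ hϑ0 hb hc hg hCg hgb hlam z
  rw [← integral_add iF iG]
  refine integral_congr_ae (Eventually.of_forall fun t => ?_)
  dsimp only
  rw [pinnedChain_act_add hω hl hN hT hβ.le hγ.le hϑ0 hϑ1 hf hg hfb hgb]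
  ring

omit hω hl hβ hγ hN hT in
/-- **`R_λ (a f) = a R_λ f`** pointwise. [folklore] -/
theorem pinnedChain_resolvent_const_mul (a : ℝ) (f : PhaseSpace N → ℝ) (lam' : ℝ) (z : PhaseSpace N) :
    ∫ t in Ioi (0 : ℝ), Real.exp (-(lam' * t)) *
        ∫ y, a * f y ∂((pinnedChain ω₂ lam β γ).transitionKernel N T T t.toNNReal z) =
      a * ∫ t in Ioi (0 : ℝ), Real.exp (-(lam' * t)) *
        ∫ y, f y ∂((pinnedChain ω₂ lam β γ).transitionKernel N T T t.toNNReal z) := by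
  rw [← integral_const_mul]
  refine integral_congr_ae (Eventually.of_forall fun t => ?_)
  dsimp only
  rw [integral_const_mul]
  ring

/-- **`R_λ (f - g) = R_λ f - R_λ g`** pointwise, for nice `f, g` and `λ > 0`. [folklore] -/
theorem pinnedChain_resolvent_sub {ϑ : ℝ} (hϑ0 : 0 < ϑ) (hϑ1 : ϑ < 1 / T)
    {f g : PhaseSpace N → ℝ} (hf : Continuous f) (hg : Continuous g) {Cf Cg : ℝ} (hCf : 0 ≤ Cf) (hCg : 0 ≤ Cg)
    (hfb : ∀ y, |f y| ≤ Cf * Real.exp (ϑ * (pinnedChain ω₂ lam β γ).hamiltonian N y))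
    (hgb : ∀ y, |g y| ≤ Cg * Real.exp (ϑ * (pinnedChain ω₂ lam β γ).hamiltonian N y))
    {lam' : ℝ} (hlam : 0 < lam') (z : PhaseSpace N) :
    ∫ t in Ioi (0 : ℝ), Real.exp (-(lam' * t)) *
        ∫ y, (f y - g y) ∂((pinnedChain ω₂ lam β γ).transitionKernel N T T t.toNNReal z) =
      (∫ t in Ioi (0 : ℝ), Real.exp (-(lam' * t)) *
        ∫ y, f y ∂((pinnedChain ω₂ lam β γ).transitionKernel N T T t.toNNReal z)) -
      ∫ t in Ioi (0 : ℝ), Real.exp (-(lam' * t)) *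
        ∫ y, g y ∂((pinnedChain ω₂ lam β γ).transitionKernel N T T t.toNNReal z) := by
  have hneg : ∀ y, |(-1) * g y| ≤ (|(-1 : ℝ)| * Cg) * Real.exp (ϑ * (pinnedChain ω₂ lam β γ).hamiltonian N y) :=
    abs_const_mul_le_exp_bound (-1) hgb
  have h := pinnedChain_resolvent_add hω hl hβ hγ hN hT hϑ0 hϑ1 hf
    ((hg.const_smul (-1 : ℝ)).congr (fun y => by simp [smul_eq_mul]) : Continuous fun y => (-1) * g y)
    hCf (by positivity) hfb hneg hlam z
  have e : (fun y => f y + (-1) * g y) = fun y => f y - g y := by funext y; ring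
  rw [e] at h
  rw [h, pinnedChain_resolvent_const_mul]
  ring

/-- **`R_λ(λF - LF) = F`** for a test function `F` and `λ > 0` (Dynkin's identity in resolvent form,
`pinnedChain_resolvent_generator`, and linearity). [cite: CuneoEckmannHairerReyBellet2018, §3 p. 7] -/
theorem pinnedChain_resolvent_sub_generator {F : PhaseSpace N → ℝ} (hF : ContDiff ℝ ∞ F)
    (hFc : HasCompactSupport F) {lam' : ℝ} (hlam : 0 < lam') (z : PhaseSpace N) :
    ∫ t in Ioi (0 : ℝ), Real.exp (-(lam' * t)) *
        ∫ y, (lam' * F y - (pinnedChain ω₂ lam β γ).generator N T T F y)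
          ∂((pinnedChain ω₂ lam β γ).transitionKernel N T T t.toNNReal z) = F z := by
  set P := pinnedChain ω₂ lam β γ with hP
  have hU1 : ContDiff ℝ 1 P.U := pinnedChain_contDiff_U ω₂ lam β γ
  have hV1 : ContDiff ℝ 1 P.V := pinnedChain_contDiff_V ω₂ lam β γ
  have hF2 : ContDiff ℝ 2 F := hF.of_le (by norm_cast)
  have hLc : Continuous (P.generator N T T F) := P.continuous_generator hU1 hV1 N T T hF2
  have hLs : HasCompactSupport (P.generator N T T F) := P.hasCompactSupport_generator N T T hF2 hFc
  obtain ⟨BF, hBF⟩ := hF.continuous.bounded_above_of_compact_support hFc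
  obtain ⟨BL, hBL⟩ := hLc.bounded_above_of_compact_support hLs
  have hϑ0 : (0 : ℝ) < 1 / (2 * T) := by positivity
  have hϑ1 : 1 / (2 * T) < 1 / T := by
    rw [div_lt_div_iff_of_pos_left one_pos (by positivity) hT]; linarith
  have hbdF : ∀ y, |F y| ≤ BF * Real.exp (1 / (2 * T) * P.hamiltonian N y) := fun y =>
    ((Real.norm_eq_abs _).symm.le.trans (hBF y)).trans
      (le_mul_of_one_le_right ((norm_nonneg _).trans (hBF y))
        (pinnedChain_one_le_exp_mul_hamiltonian hω hl hβ hϑ0.le y))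
  have hbdL : ∀ y, |P.generator N T T F y| ≤ BL * Real.exp (1 / (2 * T) * P.hamiltonian N y) := fun y =>
    ((Real.norm_eq_abs _).symm.le.trans (hBL y)).trans
      (le_mul_of_one_le_right ((norm_nonneg _).trans (hBL y))
        (pinnedChain_one_le_exp_mul_hamiltonian hω hl hβ hϑ0.le y))
  have hBF0 : 0 ≤ BF := (norm_nonneg _).trans (hBF z)
  have hBL0 : 0 ≤ BL := (norm_nonneg _).trans (hBL z)
  -- `λF - LF = λF + (-1)·LF`
  have hneg : ∀ y, |(-1) * P.generator N T T F y| ≤ (|(-1 : ℝ)| * BL) * Real.exp (1 / (2 * T) * P.hamiltonian N y) :=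
    abs_const_mul_le_exp_bound (-1) hbdL
  have hsmul : ∀ y, |lam' * F y| ≤ (|lam'| * BF) * Real.exp (1 / (2 * T) * P.hamiltonian N y) :=
    abs_const_mul_le_exp_bound lam' hbdF
  have h := pinnedChain_resolvent_add hω hl hβ hγ hN hT hϑ0 hϑ1 (hF.continuous.const_smul lam' |>.congr
    (fun y => by simp [smul_eq_mul]) : Continuous fun y => lam' * F y)
    ((hLc.const_smul (-1 : ℝ)).congr (fun y => by simp [smul_eq_mul]) : Continuous fun y => (-1) * P.generator N T T F y)
    (by positivity) (by positivity) hsmul hneg hlam z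
  have e : (fun y => lam' * F y + (-1) * P.generator N T T F y) = fun y => lam' * F y - P.generator N T T F y := by
    funext y; ring
  rw [e] at h
  rw [h, pinnedChain_resolvent_const_mul, pinnedChain_resolvent_const_mul,
    pinnedChain_resolvent_generator hω hl hβ hγ hN hT hF hFc hlam z]
  ring

/-! ### Jensen in time and the `L²(μ_T)` bound -/

/-- **Jensen in time**: for nice `f`, `λ > 0`:
`(R_λ f(z))² ≤ λ⁻¹ ∫_{(0,∞)} e^{-λt} (P_t f(z))² dt` (the probability measure `λe^{-λt}dt`).
[folklore] -/
theorem pinnedChain_sq_resolvent_le {ϑ : ℝ} (hϑ0 : 0 < ϑ) (hϑ1 : ϑ < 1 / T)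
    {f : PhaseSpace N → ℝ} (hf : Continuous f) {C : ℝ} (hC : 0 ≤ C)
    (hfb : ∀ y, |f y| ≤ C * Real.exp (ϑ * (pinnedChain ω₂ lam β γ).hamiltonian N y))
    {lam' : ℝ} (hlam : 0 < lam') (z : PhaseSpace N) :
    IntegrableOn (fun t : ℝ => Real.exp (-(lam' * t)) *
        (∫ y, f y ∂((pinnedChain ω₂ lam β γ).transitionKernel N T T t.toNNReal z)) ^ 2) (Ioi 0) ∧
    (∫ t in Ioi (0 : ℝ), Real.exp (-(lam' * t)) *
        ∫ y, f y ∂((pinnedChain ω₂ lam β γ).transitionKernel N T T t.toNNReal z)) ^ 2 ≤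
      lam'⁻¹ * ∫ t in Ioi (0 : ℝ), Real.exp (-(lam' * t)) *
        (∫ y, f y ∂((pinnedChain ω₂ lam β γ).transitionKernel N T T t.toNNReal z)) ^ 2 := by
  obtain ⟨K, c, -, hc, hb⟩ := pinnedChain_harris_bound hω hl hβ hγ hN hT hϑ0 hϑ1
  set P := pinnedChain ω₂ lam β γ with hP
  set u : ℝ → ℝ := fun t => ∫ y, f y ∂(P.transitionKernel N T T t.toNNReal z) with hu
  set w : ℝ → ℝ := fun t => Real.exp (-(lam' * t)) with hw
  set B := (|∫ y, f y ∂(P.gibbsMeasure N T)| + K * C) * Real.exp (ϑ * P.hamiltonian N z) with hB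
  have hub : ∀ t : ℝ, |u t| ≤ B := fun t => pinnedChain_abs_act_le hω hl hβ hϑ0 hb hc hf hC hfb z _
  have hB0 : 0 ≤ B := (abs_nonneg _).trans (hub 0)
  have hum : AEStronglyMeasurable u (volume.restrict (Ioi 0)) :=
    ((pinnedChain_stronglyMeasurable_act_uncurry hω hl hβ.le hγ.le T T hf.measurable).comp_measurable
      (measurable_id.prodMk measurable_const : Measurable fun t : ℝ => (t, z))).aestronglyMeasurable
  have hwc : Continuous w := Real.continuous_exp.comp (continuous_const.mul continuous_id).neg
  have hwi : IntegrableOn w (Ioi 0) := by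
    have := exp_neg_integrableOn_Ioi 0 hlam
    refine this.congr (Eventually.of_forall fun t => ?_); simp [hw, neg_mul]
  have hwu : IntegrableOn (fun t => w t * u t) (Ioi 0) :=
    pinnedChain_integrableOn_resolvent hω hl hβ hγ hϑ0 hb hc hf hC hfb hlam z
  -- `w u²` is integrable
  have hwu2 : IntegrableOn (fun t => w t * u t ^ 2) (Ioi 0) := by
    refine Integrable.mono' (hwi.const_mul (B ^ 2)) (hwc.aestronglyMeasurable.mul (hum.pow 2)) ?_
    refine (ae_restrict_iff' measurableSet_Ioi).2 (Eventually.of_forall fun t _ => ?_)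
    rw [norm_mul, Real.norm_eq_abs, Real.norm_eq_abs, abs_of_pos (Real.exp_pos _), abs_pow, mul_comm (B ^ 2)]
    exact mul_le_mul_of_nonneg_left (pow_le_pow_left₀ (abs_nonneg _) (hub t) 2) (Real.exp_pos _).le
  refine ⟨hwu2, ?_⟩
  set r := ∫ t in Ioi (0 : ℝ), w t * u t with hr
  have hw1 : ∫ t in Ioi (0 : ℝ), w t = 1 / lam' := integral_exp_neg_mul_Ioi hlam
  -- `0 ≤ ∫ w (u - λ r)² = ∫ w u² - λ r²`
  have hexp : ∫ t in Ioi (0 : ℝ), w t * (u t - lam' * r) ^ 2 =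
      (∫ t in Ioi (0 : ℝ), w t * u t ^ 2) - lam' * r ^ 2 := by
    have e : (fun t => w t * (u t - lam' * r) ^ 2) =
        fun t => w t * u t ^ 2 - (2 * lam' * r) * (w t * u t) + (lam' ^ 2 * r ^ 2) * w t := by
      funext t; ring
    rw [e, integral_add, integral_sub hwu2 (hwu.const_mul _), integral_const_mul, integral_const_mul, hw1]
    · rw [← hr]; field_simp; ring
    · exact hwu2.sub (hwu.const_mul _)
    · exact hwi.const_mul _
  have hpos : 0 ≤ ∫ t in Ioi (0 : ℝ), w t * (u t - lam' * r) ^ 2 :=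
    setIntegral_nonneg measurableSet_Ioi fun t _ => mul_nonneg (Real.exp_pos _).le (sq_nonneg _)
  rw [hexp] at hpos
  rw [inv_mul_eq_div, le_div_iff₀ hlam]
  linarith

/-- **The resolvent is `L²(μ_T)`-bounded by `λ⁻¹`**: for nice `f` (`0 < ϑ`, `2ϑ < 1/T`) and `λ > 0`,
`(R_λ f)² ∈ L¹(μ_T)` and `∫ (R_λ f)² dμ_T ≤ λ⁻² ∫ f² dμ_T` — Jensen in time
(`pinnedChain_sq_resolvent_le`), Tonelli, and the `L²(μ_T)`-contraction of the equilibrium kernels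
(`pinnedChain_integral_sq_act_le`). [folklore] -/
theorem pinnedChain_integral_sq_resolvent_le {ϑ : ℝ} (hϑ0 : 0 < ϑ) (h2ϑ : 2 * ϑ < 1 / T)
    {f : PhaseSpace N → ℝ} (hf : Continuous f) {C : ℝ} (hC : 0 ≤ C)
    (hfb : ∀ y, |f y| ≤ C * Real.exp (ϑ * (pinnedChain ω₂ lam β γ).hamiltonian N y))
    {lam' : ℝ} (hlam : 0 < lam') :
    Integrable (fun z => (∫ t in Ioi (0 : ℝ), Real.exp (-(lam' * t)) *
        ∫ y, f y ∂((pinnedChain ω₂ lam β γ).transitionKernel N T T t.toNNReal z)) ^ 2)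
      ((pinnedChain ω₂ lam β γ).gibbsMeasure N T) ∧
    ∫ z, (∫ t in Ioi (0 : ℝ), Real.exp (-(lam' * t)) *
        ∫ y, f y ∂((pinnedChain ω₂ lam β γ).transitionKernel N T T t.toNNReal z)) ^ 2
        ∂((pinnedChain ω₂ lam β γ).gibbsMeasure N T) ≤
      lam'⁻¹ ^ 2 * ∫ z, f z ^ 2 ∂((pinnedChain ω₂ lam β γ).gibbsMeasure N T) := by
  have hϑ1 : ϑ < 1 / T := by linarith
  obtain ⟨K, c, -, hc, hb⟩ := pinnedChain_harris_bound hω hl hβ hγ hN hT hϑ0 hϑ1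
  set P := pinnedChain ω₂ lam β γ with hP
  set π := P.gibbsMeasure N T with hπ
  haveI : IsProbabilityMeasure π := pinnedChain_isProbabilityMeasure_gibbsMeasure hω hl hβ.le γ N hT
  set act : ℝ → PhaseSpace N → ℝ := fun t z => ∫ y, f y ∂(P.transitionKernel N T T t.toNNReal z) with hact
  set w : ℝ → ℝ := fun t => Real.exp (-(lam' * t)) with hw
  set m := ∫ y, f y ∂π with hm
  -- the jointly measurable integrand `(z, t) ↦ w t (P_t f z)²` and its product integrability
  have hjm : StronglyMeasurable fun q : PhaseSpace N × ℝ => w q.2 * act q.2 q.1 ^ 2 := by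
    have h1 := (pinnedChain_stronglyMeasurable_act_uncurry hω hl hβ.le hγ.le T T hf.measurable).comp_measurable
      (measurable_swap : Measurable fun q : PhaseSpace N × ℝ => q.swap)
    have hwc : Continuous fun q : PhaseSpace N × ℝ => w q.2 :=
      Real.continuous_exp.comp (continuous_const.mul continuous_snd).neg
    exact hwc.stronglyMeasurable.mul (h1.pow 2 : StronglyMeasurable fun q : PhaseSpace N × ℝ => act q.2 q.1 ^ 2)
  have hbound : ∀ z t, ‖w t * act t z ^ 2‖ ≤ Real.exp (2 * ϑ * P.hamiltonian N z) * ((|m| + K * C) ^ 2 * w t) := by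
    intro z t
    have hu := pinnedChain_abs_act_le hω hl hβ hϑ0 hb hc hf hC hfb z t.toNNReal
    rw [norm_mul, Real.norm_eq_abs, Real.norm_eq_abs, abs_of_pos (Real.exp_pos _), abs_pow]
    have hsq : |act t z| ^ 2 ≤ ((|m| + K * C) * Real.exp (ϑ * P.hamiltonian N z)) ^ 2 :=
      pow_le_pow_left₀ (abs_nonneg _) hu 2
    have hE : ((|m| + K * C) * Real.exp (ϑ * P.hamiltonian N z)) ^ 2 =
        Real.exp (2 * ϑ * P.hamiltonian N z) * (|m| + K * C) ^ 2 := by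
      rw [mul_pow, ← Real.exp_nat_mul]; ring_nf
    calc w t * |act t z| ^ 2 ≤ w t * ((|m| + K * C) * Real.exp (ϑ * P.hamiltonian N z)) ^ 2 :=
          mul_le_mul_of_nonneg_left hsq (Real.exp_pos _).le
      _ = Real.exp (2 * ϑ * P.hamiltonian N z) * ((|m| + K * C) ^ 2 * w t) := by rw [hE]; ring
  have hwi : Integrable w (volume.restrict (Ioi (0 : ℝ))) := by
    have := exp_neg_integrableOn_Ioi 0 hlam
    refine this.congr (Eventually.of_forall fun t => ?_); simp [hw, neg_mul]
  have hE2 : Integrable (fun z => Real.exp (2 * ϑ * P.hamiltonian N z)) π :=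
    pinnedChain_integrable_exp_mul_hamiltonian_gibbsMeasure hω hl hβ.le γ N hT h2ϑ
  have hprod : Integrable (fun q : PhaseSpace N × ℝ => w q.2 * act q.2 q.1 ^ 2)
      (π.prod (volume.restrict (Ioi (0 : ℝ)))) := by
    refine Integrable.mono' (hE2.mul_prod (hwi.const_mul ((|m| + K * C) ^ 2))) hjm.aestronglyMeasurable ?_
    exact Eventually.of_forall fun q => hbound q.1 q.2
  -- Jensen in time, pointwise
  have hJ : ∀ z, (∫ t in Ioi (0 : ℝ), w t * act t z) ^ 2 ≤ lam'⁻¹ * ∫ t in Ioi (0 : ℝ), w t * act t z ^ 2 :=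
    fun z => (pinnedChain_sq_resolvent_le hω hl hβ hγ hN hT hϑ0 hϑ1 hf hC hfb hlam z).2
  have hint1 : Integrable (fun z => ∫ t in Ioi (0 : ℝ), w t * act t z ^ 2) π := hprod.integral_prod_left
  have hRm : AEStronglyMeasurable (fun z => (∫ t in Ioi (0 : ℝ), w t * act t z) ^ 2) π :=
    ((pinnedChain_stronglyMeasurable_resolvent hω hl hβ.le hγ.le T T hf.measurable lam').pow 2).aestronglyMeasurable
  have hnn : ∀ z, 0 ≤ ∫ t in Ioi (0 : ℝ), w t * act t z ^ 2 := fun z =>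
    setIntegral_nonneg measurableSet_Ioi fun t _ => mul_nonneg (Real.exp_pos _).le (sq_nonneg _)
  have hRint : Integrable (fun z => (∫ t in Ioi (0 : ℝ), w t * act t z) ^ 2) π := by
    refine Integrable.mono' (hint1.const_mul lam'⁻¹) hRm (Eventually.of_forall fun z => ?_)
    rw [Real.norm_eq_abs, abs_of_nonneg (sq_nonneg _)]
    exact hJ z
  refine ⟨hRint, ?_⟩
  -- integrate, swap, contract
  have hswap : ∫ z, (∫ t in Ioi (0 : ℝ), w t * act t z ^ 2) ∂π = ∫ t in Ioi (0 : ℝ), (∫ z, w t * act t z ^ 2 ∂π) :=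
    integral_integral_swap hprod
  have hcontr : ∀ t : ℝ, ∫ z, w t * act t z ^ 2 ∂π ≤ w t * ∫ z, f z ^ 2 ∂π := by
    intro t
    rw [integral_const_mul]
    exact mul_le_mul_of_nonneg_left (pinnedChain_integral_sq_act_le hω hl hβ hγ hN hT hϑ0 h2ϑ hf hfb t.toNNReal).2.2
      (Real.exp_pos _).le
  have hint2 : Integrable (fun t => ∫ z, w t * act t z ^ 2 ∂π) (volume.restrict (Ioi (0 : ℝ))) :=
    hprod.integral_prod_right
  calc ∫ z, (∫ t in Ioi (0 : ℝ), w t * act t z) ^ 2 ∂π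
      ≤ ∫ z, lam'⁻¹ * (∫ t in Ioi (0 : ℝ), w t * act t z ^ 2) ∂π :=
        integral_mono hRint (hint1.const_mul _) hJ
    _ = lam'⁻¹ * ∫ t in Ioi (0 : ℝ), (∫ z, w t * act t z ^ 2 ∂π) := by rw [integral_const_mul, hswap]
    _ ≤ lam'⁻¹ * ∫ t in Ioi (0 : ℝ), w t * (∫ z, f z ^ 2 ∂π) := by
        refine mul_le_mul_of_nonneg_left (integral_mono hint2 (hwi.mul_const _) hcontr) (inv_nonneg.2 hlam.le)
    _ = lam'⁻¹ ^ 2 * ∫ z, f z ^ 2 ∂π := by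
        rw [integral_mul_const, integral_exp_neg_mul_Ioi hlam]
        ring

end Pinned

end Summit.AtomisticToContinuum.FouriersLaw.Theorems.OddSectorIrreversibility

end
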